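import Mathlib
import Summits.NavierStokesRegularity.NavierStokesRegularity.Theorems.EulerZoomLiouvillePowerGaugeEulerLiouvilleCondenserComplexChartSets
import Summits.NavierStokesRegularity.NavierStokesRegularity.Theorems.EulerZoomLiouvillePowerGaugeEulerLiouvilleCondenserCircleMeanPacking
import Summits.NavierStokesRegularity.NavierStokesRegularity.Theorems.EulerZoomLiouvillePowerGaugeEulerLiouvilleCondenserWeightedQuietSlice
import Summits.NavierStokesRegularity.NavierStokesRegularity.Theorems.EulerZoomLiouvillePowerGaugeEulerLiouvilleCondenserCrossings

/-!
# THE PACKED CONDENSER in `ℝ³` — `N` separated crossings of one quiet plane through ONE `ℂ`-chart and ONE scalar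
(plate t47-P, steps (1)–(6); nsreg-p2 g35 ROUND-45 §3/§6 THEOREM P)

Width piece for crux `EulerZoomLiouville.PowerGaugeEulerLiouville` (stmt-NavierStokesRegularity-19832), by name under
LEAD 19832 (ns-typeII-p2 g13); seat ns-sfl-p1 g6, `--supports stmt-NavierStokesRegularity-19832 --as helper`.
The packing version of `…CondenserSharpCrossings` (t47-B′ steps): the two planar/slicing inputs are the landed plates
t47-P₀ `Condenser.circleMeanCondenserPacking` and t47-Q `Condenser.weightedQuietSlice` (ns-ezl-w2 g4), cited BY NAME.

* `exists_slice_packing_alternative_of_crossings` — STATIC FORM: `V ∈ C¹(ℝ³,ℝ³)`, unit `e`, `1 < Λ'`, ball budgets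
  `X, Y` on `B(0,(Λ+1)R)`, `‖DV‖ ≤ G_m` there, disc radius `0 < r ≤ R/2`, and on EVERY plane `⟪x,e⟫ = s`,
  `s ∈ [R, Λ'R]`, `N ≥ 1` points `pᵢ` with `‖pᵢ‖ ≤ ΛR`, `⟪V pᵢ, e⟫ ≤ −γs`, pairwise `2r < ‖pᵢ − pⱼ‖`; then some height
  `s ∈ [R, Λ'R]` satisfies the t47-P₀ alternative with `m = γs`, `A = X/(η(Λ'−1)R)` (slice Markov with `Λ := Λ'`,
  `R' := (Λ+1)R`), `E = 3Y s²/(((1+(1−η)(Λ'−1))³−1)R³)` and the factor `N`: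
  `(1−δ)γs ≤ √(2A/π)/r  ∨  (δγs/r)·exp(N·2π((1−δ)γs − √(2A/π)/r)²/E) ≤ G_m`.
  [rotate `e ↦ e₂`; weighted quiet slice; ONE chart `Φ` of the plane `{x 2 = s}` at the base point `s•e₂`; ONE scalar
  `ψ = ⟪W∘Φ, −e⟫` (`W = V∘Rot⁻¹` rotates arguments only, so `ψ(zᵢ) = −⟪V pᵢ, e⟫ ≥ γs` at the chart coordinates `zᵢ` of
  the rotated points); centres `S = {zᵢ}` a `Finset ℂ` of card `N` (the chart is isometric and the points are separated);
  disc/union budgets `setIntegral_cchart_sq_inner_le` / `…_sq_norm_fderiv_inner_le`; t47-P₀.]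
* `exists_slice_packing_alternative_of_segments` — DYNAMIC FORM: the crossings come from `N` backward similarity orbit
  segments of the cut-off flow (`‖DV‖ ≤ K`) started in `B(0,R)`, staying in `B̄(0,ΛR)`, reaching the cap `⟪·,e⟫ ≥ Λ'R`,
  and `2r`-separated at equal heights `≥ R` (first hits of every plane `⟪·,e⟫ = s`, `exists_anomalous_plane_of_exit`).

HONEST FRAMING: real analysis in `ℝ³` (with a cut-off flow); nothing here proves the crux E (19832 OPEN), any door
Target, or any Navier–Stokes statement; no summit statement is touched. [folklore (length–area method, additivity of
capacity over disjoint discs); cite: ConstantinIgnatovaVicol2026Putative, §3.4.1 for the setting]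
-/

noncomputable section

open Set Filter Topology Metric Function MeasureTheory Real
open scoped RealInnerProductSpace

set_option linter.dupNamespace false

namespace Summit.NavierStokesRegularity.NavierStokesRegularity.Theorems.PowerGaugeEulerLiouville.Condenser

open Literature.Analysis Literature.Analysis.FluidPDE

/-- The chart of the plane `{x 2 = s}` at the base point `s•e₂` hits every point of that plane:
`s•e₂ + (p 0)•e₀ + (p 1)•e₁ = p` when `p 2 = s`. [folklore] -/
theorem cchart_base_apply {p : EuclideanSpace ℝ (Fin 3)} {s : ℝ} (hp : p 2 = s) :
    s • EuclideanSpace.basisFun (Fin 3) ℝ 2 + (⟨p 0, p 1⟩ : ℂ).re • EuclideanSpace.basisFun (Fin 3) ℝ 0 +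
        (⟨p 0, p 1⟩ : ℂ).im • EuclideanSpace.basisFun (Fin 3) ℝ 1 = p := by
  ext k
  fin_cases k <;> simp [EuclideanSpace.basisFun_apply, hp]

/-- The base point `s•e₂` has norm `|s|`. [folklore] -/
theorem norm_base (s : ℝ) : ‖s • EuclideanSpace.basisFun (Fin 3) ℝ 2‖ = |s| := by
  rw [norm_smul, (EuclideanSpace.basisFun (Fin 3) ℝ).orthonormal.1 2, mul_one, Real.norm_eq_abs]

/-- **THE PACKED CONDENSER, STATIC FORM (t47-P steps (2)–(6)).**  See the module docstring. [folklore (length–area method);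
cite: ConstantinIgnatovaVicol2026Putative, §3.4.1 for the setting] -/
theorem exists_slice_packing_alternative_of_crossings
    {V : EuclideanSpace ℝ (Fin 3) → EuclideanSpace ℝ (Fin 3)} (hV : ContDiff ℝ 1 V)
    {e : EuclideanSpace ℝ (Fin 3)} (he : ‖e‖ = 1) {N : ℕ} (hN : 1 ≤ N)
    {γ R Λ Λ' η δ r X Y Gm : ℝ} (hγ : 0 < γ) (hR : 0 < R) (hΛ' : 1 < Λ') (hη : 0 < η) (hη1 : η < 1)
    (hδ : 0 < δ) (hδ1 : δ < 1) (hr : 0 < r) (hr2 : r ≤ R / 2) (hX : 0 < X) (hY : 0 < Y)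
    (hA : ∫ x in ball (0 : EuclideanSpace ℝ (Fin 3)) ((Λ + 1) * R), ‖V x‖ ^ 2 ≤ X)
    (hE : ∫ x in ball (0 : EuclideanSpace ℝ (Fin 3)) ((Λ + 1) * R), ‖fderiv ℝ V x‖ ^ 2 ≤ Y)
    (hGm : ∀ z ∈ ball (0 : EuclideanSpace ℝ (Fin 3)) ((Λ + 1) * R), ‖fderiv ℝ V z‖ ≤ Gm)
    (hcross : ∀ s ∈ Icc R (Λ' * R), ∃ p : Fin N → EuclideanSpace ℝ (Fin 3),
      (∀ i, ⟪p i, e⟫ = s) ∧ (∀ i, ‖p i‖ ≤ Λ * R) ∧ (∀ i, ⟪V (p i), e⟫ ≤ -(γ * s)) ∧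
      (∀ i j, i ≠ j → 2 * r < ‖p i - p j‖)) :
    ∃ s ∈ Icc R (Λ' * R),
      (1 - δ) * (γ * s) ≤ Real.sqrt (2 * (X / (η * (Λ' - 1) * R)) / Real.pi) / r ∨
        δ * (γ * s) / r *
            Real.exp (N * (2 * Real.pi * ((1 - δ) * (γ * s) - Real.sqrt (2 * (X / (η * (Λ' - 1) * R)) / Real.pi) / r) ^ 2) /
              (3 * Y / (((1 + (1 - η) * (Λ' - 1)) ^ 3 - 1) * R ^ 3) * s ^ 2)) ≤ Gm := by
  -- rotate `e` to `e₂`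
  set e₂ : EuclideanSpace ℝ (Fin 3) := EuclideanSpace.basisFun (Fin 3) ℝ 2 with he₂
  have he₂1 : ‖e₂‖ = 1 := (EuclideanSpace.basisFun (Fin 3) ℝ).orthonormal.1 2
  obtain ⟨Rot, hRot⟩ := exists_linearIsometryEquiv_apply_eq he he₂1
  set W : EuclideanSpace ℝ (Fin 3) → EuclideanSpace ℝ (Fin 3) := fun z => V (Rot.symm z) with hW
  have hWc : ContDiff ℝ 1 W := hV.comp Rot.symm.toContinuousLinearEquiv.contDiff
  have hWd : Differentiable ℝ W := hWc.differentiable one_ne_zero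
  have hDW : ∀ x, ‖fderiv ℝ W x‖ = ‖fderiv ℝ V (Rot.symm x)‖ := norm_fderiv_comp_linearIsometryEquiv V Rot
  have hA' : ∫ x in ball (0 : EuclideanSpace ℝ (Fin 3)) ((Λ + 1) * R), ‖W x‖ ^ 2 ≤ X := by
    have h := setIntegral_ball_comp_linearIsometryEquiv (fun x => ‖V x‖ ^ 2) Rot ((Λ + 1) * R)
    simp only [hW]
    rw [h]; exact hA
  have hE' : ∫ x in ball (0 : EuclideanSpace ℝ (Fin 3)) ((Λ + 1) * R), ‖fderiv ℝ W x‖ ^ 2 ≤ Y := by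
    have h := setIntegral_ball_comp_linearIsometryEquiv (fun x => ‖fderiv ℝ V x‖ ^ 2) Rot ((Λ + 1) * R)
    simp_rw [hDW]
    rw [h]; exact hE
  -- a weighted quiet slice (t47-Q) with height range `[R, Λ'R]` and ball `(Λ+1)R`
  obtain ⟨s, hs, hFs, hGs⟩ := weightedQuietSlice (fun x => ‖W x‖ ^ 2) (fun x => ‖fderiv ℝ W x‖ ^ 2)
    (hWc.continuous.norm.pow 2) ((hWc.continuous_fderiv one_ne_zero).norm.pow 2)
    (fun x => sq_nonneg _) (fun x => sq_nonneg _) R Λ' ((Λ + 1) * R) η X Y hR hΛ' hη hη1 hX hY hA' hE'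
  refine ⟨s, hs, ?_⟩
  have hsR : R ≤ s := hs.1
  have hspos : 0 < s := hR.trans_le hsR
  have hm : 0 < γ * s := mul_pos hγ hspos
  -- the `N` points on it, rotated, and their chart coordinates
  obtain ⟨p, hpe, hpn, hpV, hpsep⟩ := hcross s hs
  have hp'2 : ∀ i, (Rot (p i)) 2 = s := fun i => by
    rw [← EuclideanSpace.inner_basisFun_real (x := Rot (p i)) (i := 2), ← he₂, ← hRot, Rot.inner_map_map, hpe i]
  have hp'n : ∀ i, ‖Rot (p i)‖ ≤ Λ * R := fun i => by rw [Rot.norm_map]; exact hpn i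
  -- ONE chart of the plane `{x 2 = s}` at the base point `s•e₂`
  set y₀ : EuclideanSpace ℝ (Fin 3) := s • EuclideanSpace.basisFun (Fin 3) ℝ 2 with hy₀
  have hy₀2 : y₀ 2 = s := by simp [hy₀, EuclideanSpace.basisFun_apply]
  set zc : Fin N → ℂ := fun i => ⟨(Rot (p i)) 0, (Rot (p i)) 1⟩ with hzc
  have hΦz : ∀ i, y₀ + (zc i).re • EuclideanSpace.basisFun (Fin 3) ℝ 0 + (zc i).im • EuclideanSpace.basisFun (Fin 3) ℝ 1 =
      Rot (p i) := fun i => cchart_base_apply (hp'2 i)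
  have hzdist : ∀ i j, ‖zc i - zc j‖ = ‖p i - p j‖ := by
    intro i j
    rw [← norm_cchart_sub_cchart y₀ (zc i) (zc j), hΦz i, hΦz j, ← map_sub, Rot.norm_map]
  have hzinj : Function.Injective zc := by
    intro i j hij
    by_contra hne
    have h := hpsep i j hne
    rw [← hzdist i j, hij, sub_self, norm_zero] at h
    linarith
  -- ONE scalar: `ψ = ⟪W∘Φ, −e⟫` (values are not rotated, so `ψ(zᵢ) = −⟪V pᵢ, e⟫`)
  have hu1 : ‖-e‖ = 1 := by rw [norm_neg, he]
  set ψ : ℂ → ℝ := fun z =>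
    ⟪W (y₀ + z.re • EuclideanSpace.basisFun (Fin 3) ℝ 0 + z.im • EuclideanSpace.basisFun (Fin 3) ℝ 1), -e⟫ with hψ
  have hψc : ContDiff ℝ 1 ψ := contDiff_comp_cchart (f := fun x => ⟪W x, -e⟫) (hWc.inner ℝ contDiff_const) y₀
  have hψz : ∀ i, γ * s ≤ ψ (zc i) := by
    intro i
    have h1 : ψ (zc i) = -⟪V (p i), e⟫ := by
      simp only [hψ]
      rw [hΦz i, hW]
      simp only [LinearIsometryEquiv.symm_apply_apply, inner_neg_right]
    rw [h1]; linarith [hpV i]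
  -- the centres as a `Finset ℂ` of card `N`
  set S : Finset ℂ := Finset.univ.image zc with hSdef
  have hScard : S.card = N := by
    rw [hSdef, Finset.card_image_of_injective _ hzinj, Finset.card_univ, Fintype.card_fin]
  have hSne : S.Nonempty := by
    rw [← Finset.card_pos, hScard]; exact hN
  have hmemS : ∀ q ∈ S, ∃ i, zc i = q := fun q hq => by
    simpa [hSdef] using hq
  -- discs around the centres fit in `B(0,(Λ+1)R)`
  have hfit : ∀ i, ∀ w ∈ closedBall (zc i) r,
      ‖y₀ + w.re • EuclideanSpace.basisFun (Fin 3) ℝ 0 + w.im • EuclideanSpace.basisFun (Fin 3) ℝ 1‖ < (Λ + 1) * R := by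
    intro i w hw
    rw [mem_closedBall, dist_eq_norm] at hw
    have h1 := norm_cchart_sub_cchart y₀ w (zc i)
    have h2 : ‖y₀ + w.re • EuclideanSpace.basisFun (Fin 3) ℝ 0 + w.im • EuclideanSpace.basisFun (Fin 3) ℝ 1‖ ≤
        ‖(y₀ + w.re • EuclideanSpace.basisFun (Fin 3) ℝ 0 + w.im • EuclideanSpace.basisFun (Fin 3) ℝ 1) -
          (y₀ + (zc i).re • EuclideanSpace.basisFun (Fin 3) ℝ 0 + (zc i).im • EuclideanSpace.basisFun (Fin 3) ℝ 1)‖ +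
        ‖y₀ + (zc i).re • EuclideanSpace.basisFun (Fin 3) ℝ 0 + (zc i).im • EuclideanSpace.basisFun (Fin 3) ℝ 1‖ :=
      norm_le_norm_sub_add _ _
    rw [h1, hΦz i] at h2
    nlinarith [hp'n i]
  -- (P₀ i) floors at the centres
  have hmS : ∀ q ∈ S, γ * s ≤ ψ q := by
    intro q hq; obtain ⟨i, rfl⟩ := hmemS q hq; exact hψz i
  -- (P₀ ii) separation
  have hsepS : ∀ q ∈ S, ∀ q' ∈ S, q ≠ q' → 2 * r < ‖q - q'‖ := by
    intro q hq q' hq' hne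
    obtain ⟨i, rfl⟩ := hmemS q hq
    obtain ⟨j, rfl⟩ := hmemS q' hq'
    have hij : i ≠ j := fun h => hne (by rw [h])
    rw [hzdist i j]; exact hpsep i j hij
  -- (P₀ iii) gradient bound on the discs
  have hGS : ∀ q ∈ S, ∀ w ∈ closedBall q r, ‖fderiv ℝ ψ w‖ ≤ Gm := by
    intro q hq w hw
    obtain ⟨i, rfl⟩ := hmemS q hq
    refine (norm_fderiv_inner_comp_cchart_le hWd hu1.le y₀ w).trans ?_
    rw [hDW]
    apply hGm
    rw [mem_ball, dist_zero_right, Rot.symm.norm_map]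
    exact hfit i w hw
  -- (P₀ iv) amplitude budget per disc
  have hAS : ∀ q ∈ S, ∫ w in closedBall q r, ψ w ^ 2 ≤ X / (η * (Λ' - 1) * R) := by
    intro q hq
    obtain ⟨i, rfl⟩ := hmemS q hq
    have h := setIntegral_cchart_sq_inner_le hWc hu1.le (isCompact_closedBall (zc i) r) (hfit i)
    rw [hy₀2] at h
    exact h.trans hFs
  -- (P₀ v) energy budget on the union of the discs
  have hUc : IsCompact (⋃ q ∈ S, closedBall q r) := S.isCompact_biUnion fun q _ => isCompact_closedBall q r
  have hfitU : ∀ w ∈ ⋃ q ∈ S, closedBall q r,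
      ‖y₀ + w.re • EuclideanSpace.basisFun (Fin 3) ℝ 0 + w.im • EuclideanSpace.basisFun (Fin 3) ℝ 1‖ < (Λ + 1) * R := by
    intro w hw
    simp only [mem_iUnion] at hw
    obtain ⟨q, hq, hwq⟩ := hw
    obtain ⟨i, rfl⟩ := hmemS q hq
    exact hfit i w hwq
  have hEU : ∫ w in ⋃ q ∈ S, closedBall q r, ‖fderiv ℝ ψ w‖ ^ 2 ≤
      3 * Y / (((1 + (1 - η) * (Λ' - 1)) ^ 3 - 1) * R ^ 3) * s ^ 2 := by
    have h := setIntegral_cchart_sq_norm_fderiv_inner_le hWc hu1.le hUc hfitU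
    rw [hy₀2] at h
    exact h.trans hGs
  -- the slice energy budget is positive
  have hμ : 1 < 1 + (1 - η) * (Λ' - 1) := by nlinarith
  have hμ3 : 0 < (1 + (1 - η) * (Λ' - 1)) ^ 3 - 1 := by nlinarith [pow_lt_pow_left₀ hμ zero_le_one three_ne_zero]
  have hEpos : 0 < 3 * Y / (((1 + (1 - η) * (Λ' - 1)) ^ 3 - 1) * R ^ 3) * s ^ 2 := by positivity
  -- the packed circular-mean core (t47-P₀)
  have h := circleMeanCondenserPacking ψ S (γ * s) Gm (X / (η * (Λ' - 1) * R)) _ r δ hψc hSne hm hr hδ hδ1 hEpos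
    hmS hsepS hGS hAS hEU
  rw [hScard] at h
  exact h

/-- **THE PACKED CONDENSER, DYNAMIC FORM (t47-P steps (1)–(6)).**  As `exists_slice_packing_alternative_of_crossings`,
the crossings being supplied by `N` backward similarity orbit segments of the cut-off flow (`‖DV‖ ≤ K`):
labels `‖yᵢ‖ < R`, segments `Ψ_t yᵢ`, `t ∈ [0, Lᵢ]`, inside `B̄(0,ΛR)`, caps `⟪Ψ_{Lᵢ} yᵢ, e⟫ ≥ Λ'R`, and `2r`-separation
at equal heights `≥ R`; the points on the plane `⟪·,e⟫ = s` are the FIRST HITS (`exists_anomalous_plane_of_exit`,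
`⟪V, e⟫ ≤ −γs` there). [folklore; cite: ConstantinIgnatovaVicol2026Putative, §3.4.1 for the setting] -/
theorem exists_slice_packing_alternative_of_segments
    {γ : ℝ} {V : EuclideanSpace ℝ (Fin 3) → EuclideanSpace ℝ (Fin 3)} (hV : ContDiff ℝ 1 V)
    {K : ℝ} (hK : ∀ y, ‖fderiv ℝ V y‖ ≤ K)
    {e : EuclideanSpace ℝ (Fin 3)} (he : ‖e‖ = 1) {N : ℕ} (hN : 1 ≤ N)
    {R Λ Λ' η δ r X Y Gm : ℝ} (hγ : 0 < γ) (hR : 0 < R) (hΛ' : 1 < Λ') (hη : 0 < η) (hη1 : η < 1)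
    (hδ : 0 < δ) (hδ1 : δ < 1) (hr : 0 < r) (hr2 : r ≤ R / 2) (hX : 0 < X) (hY : 0 < Y)
    (hA : ∫ x in ball (0 : EuclideanSpace ℝ (Fin 3)) ((Λ + 1) * R), ‖V x‖ ^ 2 ≤ X)
    (hE : ∫ x in ball (0 : EuclideanSpace ℝ (Fin 3)) ((Λ + 1) * R), ‖fderiv ℝ V x‖ ^ 2 ≤ Y)
    (hGm : ∀ z ∈ ball (0 : EuclideanSpace ℝ (Fin 3)) ((Λ + 1) * R), ‖fderiv ℝ V z‖ ≤ Gm)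
    {y : Fin N → EuclideanSpace ℝ (Fin 3)} {L : Fin N → ℝ} (hL : ∀ i, 0 ≤ L i) (hy : ∀ i, ‖y i‖ < R)
    (hstay : ∀ i, ∀ t ∈ Icc 0 (L i),
      ‖ODE.evolutionMap (fun _ : ℝ => selfSimilarTransport γ 0 V) 0 (-t) (y i)‖ ≤ Λ * R)
    (hcap : ∀ i, Λ' * R ≤ ⟪ODE.evolutionMap (fun _ : ℝ => selfSimilarTransport γ 0 V) 0 (-(L i)) (y i), e⟫)
    (hsep : ∀ i j, i ≠ j → ∀ t ∈ Icc 0 (L i), ∀ t' ∈ Icc 0 (L j),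
      R ≤ ⟪ODE.evolutionMap (fun _ : ℝ => selfSimilarTransport γ 0 V) 0 (-t) (y i), e⟫ →
      ⟪ODE.evolutionMap (fun _ : ℝ => selfSimilarTransport γ 0 V) 0 (-t) (y i), e⟫ =
        ⟪ODE.evolutionMap (fun _ : ℝ => selfSimilarTransport γ 0 V) 0 (-t') (y j), e⟫ →
      2 * r < ‖ODE.evolutionMap (fun _ : ℝ => selfSimilarTransport γ 0 V) 0 (-t) (y i) -
        ODE.evolutionMap (fun _ : ℝ => selfSimilarTransport γ 0 V) 0 (-t') (y j)‖) :
    ∃ s ∈ Icc R (Λ' * R),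
      (1 - δ) * (γ * s) ≤ Real.sqrt (2 * (X / (η * (Λ' - 1) * R)) / Real.pi) / r ∨
        δ * (γ * s) / r *
            Real.exp (N * (2 * Real.pi * ((1 - δ) * (γ * s) - Real.sqrt (2 * (X / (η * (Λ' - 1) * R)) / Real.pi) / r) ^ 2) /
              (3 * Y / (((1 + (1 - η) * (Λ' - 1)) ^ 3 - 1) * R ^ 3) * s ^ 2)) ≤ Gm := by
  refine exists_slice_packing_alternative_of_crossings hV he hN hγ hR hΛ' hη hη1 hδ hδ1 hr hr2 hX hY hA hE hGm ?_
  intro s hs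
  -- first hit of the plane `⟪·,e⟫ = s` by every segment
  have hfirst : ∀ i, ∃ σ ∈ Ioc (0 : ℝ) (L i),
      ⟪ODE.evolutionMap (fun _ : ℝ => selfSimilarTransport γ 0 V) 0 (-σ) (y i), e⟫ = s ∧
      ⟪V (ODE.evolutionMap (fun _ : ℝ => selfSimilarTransport γ 0 V) 0 (-σ) (y i)), e⟫ ≤ -(γ * s) := by
    intro i
    have hys : ⟪y i, e⟫ < s := by
      have h1 : ⟪y i, e⟫ ≤ ‖y i‖ * ‖e‖ := real_inner_le_norm (y i) e
      rw [he, mul_one] at h1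
      linarith [hs.1, hy i]
    have hexit : s ≤ ⟪ODE.evolutionMap (fun _ : ℝ => selfSimilarTransport γ 0 V) 0 (-(L i)) (y i), e⟫ :=
      hs.2.trans (hcap i)
    obtain ⟨σ, hσ, heq, hVe, -⟩ := exists_anomalous_plane_of_exit (γ := γ) hV hK he (hL i) hys hexit
    exact ⟨σ, hσ, heq, hVe⟩
  choose σ hσ hσeq hσV using hfirst
  refine ⟨fun i => ODE.evolutionMap (fun _ : ℝ => selfSimilarTransport γ 0 V) 0 (-(σ i)) (y i),
    hσeq, fun i => hstay i (σ i) ⟨(hσ i).1.le, (hσ i).2⟩, hσV, ?_⟩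
  intro i j hij
  exact hsep i j hij (σ i) ⟨(hσ i).1.le, (hσ i).2⟩ (σ j) ⟨(hσ j).1.le, (hσ j).2⟩
    (by rw [hσeq i]; exact hs.1) (by rw [hσeq i, hσeq j])

end Summit.NavierStokesRegularity.NavierStokesRegularity.Theorems.PowerGaugeEulerLiouville.Condenser

end
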